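import Mathlib
import HarnessLib

/-!
# `NoHeavyLowerTail` (crux stmt-CriticalPhenomena-4575), antithetic vdBHK programme: the ZONE EXTENSION `T_Z(X)` as an explicit ordered set —
# partial-order axioms and the UP-SET DICTIONARY (up-sets of `T_Z(X)` = zone-pattern quadruples); generalises `AntitheticWedgePoset` from halves to zones

Support file (seat `prim-ineq-gen-7` gen 57; `--supports stmt-CriticalPhenomena-4575`).  No `sorry`, no definitions.  Memo: FINDING-NEST-g57.md §2–3.

`AntitheticZoneTransfer.zone_transfer` (this generation) proves the antipodal-Kleitman inequality of the zone extension `T_Z(X)` in QUADRUPLE FORM, relying on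
the dictionary 'up-sets of `T_Z(X)` = zone-pattern quadruples of up-sets of `X`'.  This file makes the dictionary a theorem.  DATA: a partial order `X`, a
down-set `Z ⊆ X` (the ZONE) and an up-set `U ⊆ X` disjoint from `Z` (the ANTI-ZONE; in the application `X = Ω_Q`, `Z = {D all red}`, `U = ι Z = {D all blue}`
for a nonempty down-set `D` of the poset `Q`; `D = {a}` an atom gives the half `Z = L`, `U = X ∖ L` of `AntitheticWedgePoset`).  The carrier is `X × Fin 4`
(sheet `0 = (vR,tB), 1 = (vR,tR), 2 = (vB,tB), 3 = (vB,tR)`: colours of the NEW ATOM `v` and the NEW TOP `t > D ∪ {v}`), the relation (spelled out inline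
in every statement; no definitions in this file) is: `p.1 ≤ q.1` and the SHEET CONDITION: same sheet, or `0→2`, `1→3`, `0→3` (always), `2→3` (source
outside `U`), `0→1` (target outside `Z`), `1→2` (source in `Z`, target in `U`); nothing else.  [Sign-model derivation (memo §2): `t` is red-interior iff
`v` red and `s ∈ Z`, blue-interior iff `v` blue and `s ∈ U`; otherwise `t` is dead; the order of a colouring poset is coordinatewise in `Λ = {RI,BN}<{RN,BI}`.]
* `zle_refl`, `zle_trans` (for a down-set `Z` and an up-set `U`), `zle_antisymm` — the relation is a partial order on `X × Fin 4`.
* `upset_iff` — for `Z ∩ U = ∅` (nothing else is needed), a finite `W ⊆ X × Fin 4` is up-closed for the relation iff its sheets `W_i = {s : (s,i) ∈ W}` are up-sets of `X`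
  with `W₀ ⊆ W₂`, `W₁ ⊆ W₃`, `s ∈ W₂, s ∉ U, s ≤ t ⟹ t ∈ W₃`, `s ∈ W₀, s ≤ t, t ∉ Z ⟹ t ∈ W₁`, `s ∈ W₁ ∩ Z, s ≤ t, t ∈ U ⟹ t ∈ W₂` — the ZONE
  PATTERN of `zone_transfer` (there indexed `1..4`), literally in the same form.
For `X = Ω_Q`, `Z = {D red}`, `U = {D blue}` the ordered set `X × Fin 4` (with this relation) is the colouring poset `Ω_{Q + v + t}` (machine-checked
relation by relation and up-set by up-set for all `(Q,D)` with `|Q| ≤ 3`, memo §2), so with `zone_transfer` every exact instance of the zone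
rearrangement inequality ZR — all 105 pairs `(Q,D)` with `|Q| ≤ 4` (minimum exactly 0), kit j310373 at `|Q| = 5` — is an AK colouring poset two
elements larger.  This is the transfer theorem behind the NEST-POINT REDUCTION of CONJECTURE Cβ (memo §1): 'pendant nest atom under a single top'.
-/

namespace Summit.CriticalPhenomena.PercolationContinuityZ3.Theorems

open Finset

namespace AntitheticZonePoset

variable {X : Type*} [PartialOrder X]

/-- The zone-extension relation is reflexive. [this work] -/
theorem zle_refl (Z U : Finset X) (p : X × Fin 4) :
    (p.1 ≤ p.1 ∧ (p.2 = p.2 ∨ (p.2 = 0 ∧ p.2 = 2) ∨ (p.2 = 1 ∧ p.2 = 3) ∨ (p.2 = 0 ∧ p.2 = 3) ∨ (p.2 = 2 ∧ p.2 = 3 ∧ p.1 ∉ U) ∨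
        (p.2 = 0 ∧ p.2 = 1 ∧ p.1 ∉ Z) ∨ (p.2 = 1 ∧ p.2 = 2 ∧ p.1 ∈ Z ∧ p.1 ∈ U))) :=
  ⟨le_rfl, Or.inl rfl⟩

/-- The zone-extension relation is transitive when `Z` is a down-set and `U` is an up-set (64 sheet cases). [this work] -/
theorem zle_trans (Z U : Finset X) (hZdown : ∀ x y : X, x ≤ y → y ∈ Z → x ∈ Z) (hUup : ∀ x y : X, x ≤ y → x ∈ U → y ∈ U)
    (p q r : X × Fin 4)
    (hpq : (p.1 ≤ q.1 ∧ (p.2 = q.2 ∨ (p.2 = 0 ∧ q.2 = 2) ∨ (p.2 = 1 ∧ q.2 = 3) ∨ (p.2 = 0 ∧ q.2 = 3) ∨ (p.2 = 2 ∧ q.2 = 3 ∧ p.1 ∉ U) ∨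
        (p.2 = 0 ∧ q.2 = 1 ∧ q.1 ∉ Z) ∨ (p.2 = 1 ∧ q.2 = 2 ∧ p.1 ∈ Z ∧ q.1 ∈ U))))
    (hqr : (q.1 ≤ r.1 ∧ (q.2 = r.2 ∨ (q.2 = 0 ∧ r.2 = 2) ∨ (q.2 = 1 ∧ r.2 = 3) ∨ (q.2 = 0 ∧ r.2 = 3) ∨ (q.2 = 2 ∧ r.2 = 3 ∧ q.1 ∉ U) ∨
        (q.2 = 0 ∧ r.2 = 1 ∧ r.1 ∉ Z) ∨ (q.2 = 1 ∧ r.2 = 2 ∧ q.1 ∈ Z ∧ r.1 ∈ U)))) :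
    (p.1 ≤ r.1 ∧ (p.2 = r.2 ∨ (p.2 = 0 ∧ r.2 = 2) ∨ (p.2 = 1 ∧ r.2 = 3) ∨ (p.2 = 0 ∧ r.2 = 3) ∨ (p.2 = 2 ∧ r.2 = 3 ∧ p.1 ∉ U) ∨
        (p.2 = 0 ∧ r.2 = 1 ∧ r.1 ∉ Z) ∨ (p.2 = 1 ∧ r.2 = 2 ∧ p.1 ∈ Z ∧ r.1 ∈ U))) := by
  obtain ⟨s, i⟩ := p
  obtain ⟨t, j⟩ := q
  obtain ⟨u, k⟩ := r
  obtain ⟨hst, c1⟩ := hpq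
  obtain ⟨htu, c2⟩ := hqr
  refine ⟨le_trans hst htu, ?_⟩
  simp only at hst htu c1 c2 ⊢
  -- membership transport along the chain s ≤ t ≤ u
  have d1 : t ∈ Z → s ∈ Z := fun h => hZdown s t hst h
  have d2 : u ∈ Z → t ∈ Z := fun h => hZdown t u htu h
  have n1 : t ∉ Z → u ∉ Z := fun h hu => h (d2 hu)
  have e1 : s ∈ U → t ∈ U := fun h => hUup s t hst h
  have e2 : t ∈ U → u ∈ U := fun h => hUup t u htu h
  have m1 : t ∉ U → s ∉ U := fun h hs => h (e1 hs)
  fin_cases i <;> fin_cases j <;> fin_cases k <;> simp at c1 c2 ⊢ <;> tauto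

/-- The zone-extension relation is antisymmetric (the sheet condition has no 2-cycles). [this work] -/
theorem zle_antisymm (Z U : Finset X) (p q : X × Fin 4)
    (hpq : (p.1 ≤ q.1 ∧ (p.2 = q.2 ∨ (p.2 = 0 ∧ q.2 = 2) ∨ (p.2 = 1 ∧ q.2 = 3) ∨ (p.2 = 0 ∧ q.2 = 3) ∨ (p.2 = 2 ∧ q.2 = 3 ∧ p.1 ∉ U) ∨
        (p.2 = 0 ∧ q.2 = 1 ∧ q.1 ∉ Z) ∨ (p.2 = 1 ∧ q.2 = 2 ∧ p.1 ∈ Z ∧ q.1 ∈ U))))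
    (hqp : (q.1 ≤ p.1 ∧ (q.2 = p.2 ∨ (q.2 = 0 ∧ p.2 = 2) ∨ (q.2 = 1 ∧ p.2 = 3) ∨ (q.2 = 0 ∧ p.2 = 3) ∨ (q.2 = 2 ∧ p.2 = 3 ∧ q.1 ∉ U) ∨
        (q.2 = 0 ∧ p.2 = 1 ∧ p.1 ∉ Z) ∨ (q.2 = 1 ∧ p.2 = 2 ∧ q.1 ∈ Z ∧ p.1 ∈ U)))) : p = q := by
  obtain ⟨s, i⟩ := p
  obtain ⟨t, j⟩ := q
  obtain ⟨hst, c1⟩ := hpq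
  obtain ⟨hts, c2⟩ := hqp
  simp only at hst hts c1 c2
  have hs : s = t := le_antisymm hst hts
  subst hs
  fin_cases i <;> fin_cases j <;> simp at c1 c2 ⊢

/-- **UP-SET DICTIONARY.**  For disjoint `Z, U` (no down-set or up-set hypothesis is needed here) and a finite `W ⊆ X × Fin 4`: `W` is up-closed for the
zone-extension relation iff its four sheets are up-sets of `X` satisfying the ZONE PATTERN (the dictionary behind `AntitheticZoneTransfer.zone_transfer`, in
the same two-point form). [this work] -/
theorem upset_iff (Z U : Finset X) (hZU : ∀ x, x ∈ Z → x ∉ U) (W : Finset (X × Fin 4)) :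
    (∀ p q : X × Fin 4,
        (p.1 ≤ q.1 ∧ (p.2 = q.2 ∨ (p.2 = 0 ∧ q.2 = 2) ∨ (p.2 = 1 ∧ q.2 = 3) ∨ (p.2 = 0 ∧ q.2 = 3) ∨ (p.2 = 2 ∧ q.2 = 3 ∧ p.1 ∉ U) ∨
        (p.2 = 0 ∧ q.2 = 1 ∧ q.1 ∉ Z) ∨ (p.2 = 1 ∧ q.2 = 2 ∧ p.1 ∈ Z ∧ q.1 ∈ U))) →
        p ∈ W → q ∈ W) ↔
      ((∀ i : Fin 4, ∀ s t : X, s ≤ t → (s, i) ∈ W → (t, i) ∈ W) ∧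
        (∀ s, (s, (0 : Fin 4)) ∈ W → (s, (2 : Fin 4)) ∈ W) ∧
        (∀ s, (s, (1 : Fin 4)) ∈ W → (s, (3 : Fin 4)) ∈ W) ∧
        (∀ s t, s ≤ t → s ∉ U → (s, (2 : Fin 4)) ∈ W → (t, (3 : Fin 4)) ∈ W) ∧
        (∀ s t, s ≤ t → t ∉ Z → (s, (0 : Fin 4)) ∈ W → (t, (1 : Fin 4)) ∈ W) ∧
        (∀ s t, s ≤ t → s ∈ Z → t ∈ U → (s, (1 : Fin 4)) ∈ W → (t, (2 : Fin 4)) ∈ W)) := by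
  constructor
  · intro hW
    refine ⟨?_, ?_, ?_, ?_, ?_, ?_⟩
    · intro i s t hst hs
      exact hW (s, i) (t, i) ⟨hst, Or.inl rfl⟩ hs
    · intro s hs
      exact hW (s, 0) (s, 2) ⟨le_rfl, by simp⟩ hs
    · intro s hs
      exact hW (s, 1) (s, 3) ⟨le_rfl, by simp⟩ hs
    · intro s t hst hsU hs
      exact hW (s, 2) (t, 3) ⟨hst, by simp [hsU]⟩ hs
    · intro s t hst htZ hs
      exact hW (s, 0) (t, 1) ⟨hst, by simp [htZ]⟩ hs
    · intro s t hst hsZ htU hs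
      exact hW (s, 1) (t, 2) ⟨hst, by simp [hsZ, htU]⟩ hs
  · rintro ⟨hup, h02, h13, h23, h01, hC12⟩ p q hpq hp
    obtain ⟨s, i⟩ := p
    obtain ⟨t, j⟩ := q
    obtain ⟨hst, c⟩ := hpq
    simp only at hst c
    rcases c with h | ⟨hi, hj⟩ | ⟨hi, hj⟩ | ⟨hi, hj⟩ | ⟨hi, hj, hsU⟩ | ⟨hi, hj, htZ⟩ | ⟨hi, hj, hsZ, htU⟩
    · subst h; exact hup i s t hst hp
    · subst hi; subst hj; exact hup 2 s t hst (h02 s hp)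
    · subst hi; subst hj; exact hup 3 s t hst (h13 s hp)
    · subst hi; subst hj
      -- (vR,tB) → (vB,tR): through sheet 2 if s ∈ Z (then s ∉ U), through sheet 1 at s otherwise
      by_cases hsZ : s ∈ Z
      · exact h23 s t hst (hZU s hsZ) (h02 s hp)
      · exact hup 3 s t hst (h13 s (h01 s s le_rfl hsZ hp))
    · subst hi; subst hj; exact h23 s t hst hsU hp
    · subst hi; subst hj; exact h01 s t hst htZ hp
    · subst hi; subst hj; exact hC12 s t hst hsZ htU hp

end AntitheticZonePoset

end Summit.CriticalPhenomena.PercolationContinuityZ3.Theorems
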